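import Literature.AlgebraicGeometry.HodgeTheory.WeilClassesDescendingHolds
import Literature.AlgebraicGeometry.HodgeTheory.HyperbolicWeilTypeExistence
import Literature.AlgebraicGeometry.HodgeTheory.EllipticCurvePowersHodgeClasses
import Literature.AlgebraicGeometry.HodgeTheory.HyperplaneClassRational
import Literature.AlgebraicGeometry.Motives.SegreHyperplaneClass
import HarnessLib

/-!
# Route `FirstOrderSemiregularSeeds`, crux X2′ `FirstOrderWeilSeedsEightC` (item stmt-HodgeConjecture-23714), line `birthC`:
# the pinned CM anchor `S_d⁴`, `S_d = E₀ × E₀`, `Ψ = (ψ₀ × (−ψ₀))⁴` — HYPERBOLIC, with a non-zero rational ALGEBRAIC Weil class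

HONEST FRAMING. Nothing here proves X2′, X1, rung H2, HC for abelian varieties or the Hodge conjecture. UNCONDITIONAL
`--supports` lemmas for the registered stub `stub_kappaDesign_pad4` of `Cruxes/FirstOrderWeilSeedsEight/Lines/birthC.lean`
(be6186eb62c4): the ANCHOR half of its data (everything the stub asks except the finite locally free κ-design). The
skeleton's abbreviations `weilSurfAct`, `pad4Anchor`, `pad4Action` are SPELLED OUT (no definition, no notation); the
eightfold statements take the nested action as a variable `Ψ` with `hΨ : Ψ = (ψ₀ × (−ψ₀))⁴`, instantiated in the
skeleton by `pad4Action E₀ ψ₀` and `rfl`.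

* §1 the CM square `S = E₀ × E₀`, `φ_S = ψ₀ × (−ψ₀)` carries a non-zero rational `(1,1)` Weil class
  (`exists_weilType_cmSquare` and `E₊ ⊓ E₋ = 0`);
* §2 the inductive step: for a `2n`-fold `(A, φ)` with a non-zero rational `(n,n)` Weil class, `(A × S, φ × φ_S)` is
  HYPERBOLIC for a `K`-symmetrised hyperplane class (the tree's aiming theorem `Motives.aimedSplitProduct_cmSquare_of_pos`,
  Markman §11.5 Step 2 / van Geemen 5.3) and carries the next non-zero rational `(n+1,n+1)` Weil class
  (`exists_rational_hodge_weilClass_of_isHyperbolicWeilType`);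
* §3 for EVERY CM datum `(E₀, ψ₀)`, `ψ₀² = -d`, `d ≥ 1`: `(S⁴, Ψ)` has `dim = 8`, `Ψ² = -d`, is HYPERBOLIC in
  half-dimension `4` for `d·e^*a + Ψ^*e^*a` (some projective embedding `e`, rational `a ≠ 0`), has a non-zero rational
  `(4,4)` Weil class, and ALL rational Hodge classes of `S⁴` are ALGEBRAIC (Tate–Murasaki, the tree's
  `EllSlots.hodgeClasses_algebraic'`) — HC holds AT the anchor, which says nothing about a bundle carrying a Weil class;
* §4 for any `(P, ψ)` with `ψ² = -d` and any embedding `e` with rational `a ≠ 0`, the `K`-symmetrised class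
  `d·e^*a + ψ^*e^*a` is a non-zero rational multiple of the hyperplane class of ANOTHER projective embedding (graph of
  `ψ`, Segre–diagonal power, Segre: the first half of the tree's `exists_symmetricSegreEmbedding`, for an arbitrary `e`).

The κ-design half of the stub is NOT here: see the companion file `…FirstOrderWeilSeedsEightCKappaDesignPad4`
(conditional on a K-theoretic named fact) and its module docstring for why no unconditional construction of a finite
locally free module with a Weil-bearing Chern character exists in the tree today.

## References

[cite: Markman2025SurveySecant, §11.5 Step 2] [cite: vanGeemen1994HodgeAV, 4.3, 4.9, Lemma 5.2, 5.3–5.4]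
[cite: Deligne1982HodgeCycles, Prop. 4.4] [cite: Gordon1997, §3] [cite: Hartshorne1977, II Ex. 5.11–5.12]
[cite: SilvermanAEC2009, VI Thm. 4.1 (b)]
-/

noncomputable section

-- single-problem summit (Problem = Summit): the mandated namespace repeats `HodgeConjecture`.
set_option linter.dupNamespace false

open CategoryTheory AlgebraicGeometry
open Literature.AlgebraicGeometry Literature.AlgebraicGeometry.Motives Literature.AlgebraicGeometry.HodgeTheory
open Literature.AlgebraicTopology.SingularHomology

namespace Summit.HodgeConjecture.HodgeConjecture.Theorems

/-! ## §1 The CM square `S = E₀ × E₀`, `φ_S = ψ₀ × (−ψ₀)`: a non-zero rational `(1,1)` Weil class -/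

section CMSquare

variable {E₀ : AbelianVariety ℂ} {ψ₀ : E₀ ⟶ E₀} {d : ℕ}

/-- **The CM square carries a non-zero rational Weil class of type `(1,1)`**: with `u₊ ∈ E₊`, `u₋ ∈ E₋` the generators
of the two Weil lines of `(E₀ × E₀, ψ₀ × (−ψ₀))` (`exists_weilType_cmSquare`: `u₊ + u₋` rational of type `(1,1)`,
`u± ≠ 0`), the class `u₊ + u₋ ∈ E₊ ⊔ E₋` is non-zero because `E₊ ⊓ E₋ = 0` (`disjoint_weilClassesPlus_weilClassesMinus`).
[cite: vanGeemen1994HodgeAV, 4.9 and 5.3] -/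
theorem cmSquare_exists_rational_hodge_weilClass (hE : E₀.dim = 1) (hd : 0 < d) (hψ : ψ₀ ≫ ψ₀ = -(d • 𝟙 E₀)) :
    ∃ c : complexBetti (E₀.prod E₀).X (2 * 1), IsRationalClass c ∧
      IsOfHodgeType (2 * 1) (E₀.prod E₀).X (2 * 1) 1 1 c ∧
      c ∈ weilClassesOf (E₀.prod E₀)
        (AbelianVariety.prodLift (AbelianVariety.fst E₀ E₀ ≫ ψ₀) (AbelianVariety.snd E₀ E₀ ≫ (-ψ₀))) 1 d ∧
      c ≠ 0 := by
  obtain ⟨-, -, -, up, um, hup, hum, hrat, htyp, hup0, -⟩ := exists_weilType_cmSquare hE hd hψ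
  refine ⟨up + um, hrat, htyp, Submodule.add_mem _ (weilClassesPlus_le_weilClassesOf _ _ 1 d hup)
    (weilClassesMinus_le_weilClassesOf _ _ 1 d hum), fun h0 ↦ hup0 ?_⟩
  have hdis := disjoint_weilClassesPlus_weilClassesMinus (A := E₀.prod E₀)
    (φ := AbelianVariety.prodLift (AbelianVariety.fst E₀ E₀ ≫ ψ₀) (AbelianVariety.snd E₀ E₀ ≫ (-ψ₀)))
    (n := 1) (d := d) one_pos hd
  have hmem : up ∈ weilClassesMinus (E₀.prod E₀)
      (AbelianVariety.prodLift (AbelianVariety.fst E₀ E₀ ≫ ψ₀) (AbelianVariety.snd E₀ E₀ ≫ (-ψ₀))) 1 d := by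
    rw [eq_neg_of_add_eq_zero_left h0]; exact Submodule.neg_mem _ hum
  exact (Submodule.disjoint_def.1 hdis) up hup hmem

end CMSquare

/-! ## §2 One dimension up with the CM square as partner (hyperbolicity AND the next Weil class) -/

section Step

variable {E₀ : AbelianVariety ℂ} {ψ₀ : E₀ ⟶ E₀} {d : ℕ}

/-- **The inductive step on the CM tower.** For a `2n`-fold `(A, φ)` (`n ≥ 1`, `φ² = -d`) with a non-zero rational
`(n,n)` Weil class, the product `(A × S, φ × φ_S)` with the CM square `(S, φ_S) = (E₀ × E₀, ψ₀ × (−ψ₀))` has dimension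
`2(n+1)`, satisfies `(φ × φ_S)² = -d`, is HYPERBOLIC for the `K`-symmetrised hyperplane class of some projective embedding
(`Motives.aimedSplitProduct_cmSquare_of_pos`), and therefore carries a non-zero rational `(n+1,n+1)` Weil class
(`exists_rational_hodge_weilClass_of_isHyperbolicWeilType`) — the input of the next step.
[cite: Markman2025SurveySecant, §11.5 Step 2] [cite: vanGeemen1994HodgeAV, 4.9, Lemma 5.2 and 5.3] [cite: Deligne1982HodgeCycles, Prop. 4.4] -/
theorem prod_cmSquare_hyperbolic_step (hE : E₀.dim = 1) (hd : 0 < d) (hψ : ψ₀ ≫ ψ₀ = -(d • 𝟙 E₀)) {n : ℕ}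
    (hn : 0 < n) {A : AbelianVariety ℂ} {φ : A ⟶ A} (hA : A.dim = 2 * n) (hφ : φ ≫ φ = -(d • 𝟙 A))
    (hW : ∃ c : complexBetti A.X (2 * n), IsRationalClass c ∧ IsOfHodgeType (2 * n) A.X (2 * n) n n c ∧
      c ∈ weilClassesOf A φ n d ∧ c ≠ 0)
    (Φ : A.prod (E₀.prod E₀) ⟶ A.prod (E₀.prod E₀))
    (hΦ : Φ = AbelianVariety.prodLift (AbelianVariety.fst A (E₀.prod E₀) ≫ φ)
      (AbelianVariety.snd A (E₀.prod E₀) ≫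
        AbelianVariety.prodLift (AbelianVariety.fst E₀ E₀ ≫ ψ₀) (AbelianVariety.snd E₀ E₀ ≫ (-ψ₀)))) :
    (A.prod (E₀.prod E₀)).dim = 2 * (n + 1) ∧ Φ ≫ Φ = -(d • 𝟙 (A.prod (E₀.prod E₀))) ∧
    (∃ (e : ProjectiveEmbedding (A.prod (E₀.prod E₀)).X) (a : complexBetti (projectiveSpace e.n ℂ) 2),
      IsRationalClass a ∧ a ≠ 0 ∧
      IsHyperbolicWeilType (A.prod (E₀.prod E₀)) Φ (n + 1)
        ((d : ℂ) • complexBetti.map e.ι 2 a + complexBetti.map Φ.hom.hom.hom 2 (complexBetti.map e.ι 2 a))) ∧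
    (∃ c : complexBetti (A.prod (E₀.prod E₀)).X (2 * (n + 1)), IsRationalClass c ∧
      IsOfHodgeType (2 * (n + 1)) (A.prod (E₀.prod E₀)).X (2 * (n + 1)) (n + 1) (n + 1) c ∧
      c ∈ weilClassesOf (A.prod (E₀.prod E₀)) Φ (n + 1) d ∧ c ≠ 0) := by
  subst hΦ
  obtain ⟨hS, -, hφS, -⟩ := exists_weilType_cmSquare hE hd hψ
  have hdim : (A.prod (E₀.prod E₀)).dim = 2 * (n + 1) := dim_prod_eq_two_mul hA hS
  have hsq := prodLift_comp_self_eq_neg_nsmul hφ hφS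
  obtain ⟨e, a, ha, ha0, hhyp⟩ := aimedSplitProduct_cmSquare_of_pos hd hE hψ hn hA hφ hW
  exact ⟨hdim, hsq, ⟨e, a, ha, ha0, hhyp⟩,
    exists_rational_hodge_weilClass_of_isHyperbolicWeilType (Nat.succ_pos n) hd hdim hsq e ha ha0 hhyp⟩

end Step

/-! ## §3 The PAD-4 anchor `S⁴ = ((S × S) × S) × S`: hyperbolic, with a non-zero rational `(4,4)` Weil class; HC at the anchor -/

section Pad

variable {E₀ : AbelianVariety ℂ} {ψ₀ : E₀ ⟶ E₀} {d : ℕ}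

/-- **The PAD-4 anchor is a hyperbolic `√-d`-Weil eightfold with a non-zero rational `(4,4)` Weil class** — for EVERY
CM datum `(E₀, ψ₀)`, `ψ₀² = -d`, `d ≥ 1`, and the nested action `Ψ = (ψ₀ × (−ψ₀))⁴` (the skeleton's `pad4Action E₀ ψ₀`,
given here as `Ψ` with its defining equation `hΨ`, discharged by `rfl`): `dim S⁴ = 8`, `Ψ² = -d`, `(S⁴, Ψ)` is of
HYPERBOLIC Weil type in half-dimension `4` for the `K`-symmetrised hyperplane class `d·e^*a + Ψ^*e^*a` of some projective
embedding `e` and rational `a ≠ 0`, and its Weil plane has a non-zero rational class of type `(4,4)`. Three applications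
of `prod_cmSquare_hyperbolic_step` starting from the CM square (UNCONDITIONAL; the anchor half of the data of
`stub_kappaDesign_pad4`). [cite: Markman2025SurveySecant, §11.5 Step 2] [cite: vanGeemen1994HodgeAV, Lemma 5.2, 5.3–5.4] -/
theorem pad4Anchor_hyperbolic_weilClass (hE : E₀.dim = 1) (hd : 0 < d) (hψ : ψ₀ ≫ ψ₀ = -(d • 𝟙 E₀))
    (Ψ : (((E₀.prod E₀).prod (E₀.prod E₀)).prod (E₀.prod E₀)).prod (E₀.prod E₀) ⟶
      (((E₀.prod E₀).prod (E₀.prod E₀)).prod (E₀.prod E₀)).prod (E₀.prod E₀))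
    (hΨ : Ψ = AbelianVariety.prodLift
        (AbelianVariety.fst (((E₀.prod E₀).prod (E₀.prod E₀)).prod (E₀.prod E₀)) (E₀.prod E₀) ≫
          AbelianVariety.prodLift
            (AbelianVariety.fst ((E₀.prod E₀).prod (E₀.prod E₀)) (E₀.prod E₀) ≫
              AbelianVariety.prodLift
                (AbelianVariety.fst (E₀.prod E₀) (E₀.prod E₀) ≫
                  AbelianVariety.prodLift (AbelianVariety.fst E₀ E₀ ≫ ψ₀) (AbelianVariety.snd E₀ E₀ ≫ (-ψ₀)))
                (AbelianVariety.snd (E₀.prod E₀) (E₀.prod E₀) ≫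
                  AbelianVariety.prodLift (AbelianVariety.fst E₀ E₀ ≫ ψ₀) (AbelianVariety.snd E₀ E₀ ≫ (-ψ₀))))
            (AbelianVariety.snd ((E₀.prod E₀).prod (E₀.prod E₀)) (E₀.prod E₀) ≫
              AbelianVariety.prodLift (AbelianVariety.fst E₀ E₀ ≫ ψ₀) (AbelianVariety.snd E₀ E₀ ≫ (-ψ₀))))
        (AbelianVariety.snd (((E₀.prod E₀).prod (E₀.prod E₀)).prod (E₀.prod E₀)) (E₀.prod E₀) ≫
          AbelianVariety.prodLift (AbelianVariety.fst E₀ E₀ ≫ ψ₀) (AbelianVariety.snd E₀ E₀ ≫ (-ψ₀)))) :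
    ((((E₀.prod E₀).prod (E₀.prod E₀)).prod (E₀.prod E₀)).prod (E₀.prod E₀)).dim = 2 * 4 ∧
    Ψ ≫ Ψ = -(d • 𝟙 _) ∧
    (∃ (e : ProjectiveEmbedding ((((E₀.prod E₀).prod (E₀.prod E₀)).prod (E₀.prod E₀)).prod (E₀.prod E₀)).X)
      (a : complexBetti (projectiveSpace e.n ℂ) 2),
      IsRationalClass a ∧ a ≠ 0 ∧
      IsHyperbolicWeilType _ Ψ 4
        ((d : ℂ) • complexBetti.map e.ι 2 a + complexBetti.map Ψ.hom.hom.hom 2 (complexBetti.map e.ι 2 a))) ∧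
    (∃ c : complexBetti ((((E₀.prod E₀).prod (E₀.prod E₀)).prod (E₀.prod E₀)).prod (E₀.prod E₀)).X (2 * 4),
      IsRationalClass c ∧ IsOfHodgeType (2 * 4) _ (2 * 4) 4 4 c ∧ c ∈ weilClassesOf _ Ψ 4 d ∧ c ≠ 0) := by
  obtain ⟨hS, -, hφS, -⟩ := exists_weilType_cmSquare hE hd hψ
  obtain ⟨h2d, h2s, -, h2W⟩ := prod_cmSquare_hyperbolic_step hE hd hψ one_pos hS hφS
    (cmSquare_exists_rational_hodge_weilClass hE hd hψ) _ rfl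
  obtain ⟨h3d, h3s, -, h3W⟩ := prod_cmSquare_hyperbolic_step hE hd hψ two_pos h2d h2s h2W _ rfl
  exact prod_cmSquare_hyperbolic_step hE hd hψ three_pos h3d h3s h3W Ψ hΨ

/-- **Every rational Hodge class on the PAD-4 anchor is ALGEBRAIC** (Tate–Murasaki: the Hodge ring of a product of copies
of an elliptic curve is generated by divisors; the tree's `EllSlots.hodgeClasses_algebraic'` on the bracketing
`((S × S) × S) × S`, `S = E₀ × E₀`, with the slot structure assembled by `ellSlots_self` and `EllSlots.prod`). In
particular the Weil classes of `(S⁴, Ψ)` are algebraic AT THE ANCHOR. [cite: vanGeemen1994HodgeAV, Thm. 4.3] [cite: Gordon1997, §3] -/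
theorem pad4Anchor_hodgeClass_mem_algebraicClasses (hE : E₀.dim = 1) {p : ℕ}
    {c : complexBetti ((((E₀.prod E₀).prod (E₀.prod E₀)).prod (E₀.prod E₀)).prod (E₀.prod E₀)).X (2 * p)}
    (hcQ : IsRationalClass c)
    (hc : IsOfHodgeType (2 * 4) ((((E₀.prod E₀).prod (E₀.prod E₀)).prod (E₀.prod E₀)).prod (E₀.prod E₀)).X (2 * p) p p c) :
    c ∈ algebraicClasses ((((E₀.prod E₀).prod (E₀.prod E₀)).prod (E₀.prod E₀)).prod (E₀.prod E₀)).X p := by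
  have h1 := (ellSlots_self hE).prod (ellSlots_self hE)
  have h4 := ((h1.prod h1).prod h1).prod h1
  have hdim : ((((E₀.prod E₀).prod (E₀.prod E₀)).prod (E₀.prod E₀)).prod (E₀.prod E₀)).dim = 2 * 4 := by
    simp only [AbelianVariety.dim_prod, hE]
  exact h4.hodgeClasses_algebraic' hE p c hcQ (by rw [hdim]; exact hc)

end Pad

/-! ## §4 The `K`-symmetrised re-embedding: `h_K = d·e^*a + ψ^*e^*a` is a rational multiple of a hyperplane class -/

section Reembed

open MonoidalCategory CartesianMonoidalCategory
open Literature.AlgebraicGeometry.Motives.SegreHyperplaneClass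

/-- **The `K`-symmetrised class is (a non-zero rational multiple of) a hyperplane class.** For an abelian variety `P`
with `ψ ≫ ψ = -(d • 𝟙)` (`d ≥ 1`), a projective embedding `e : P ↪ ℙⁿ` and a non-zero rational `a ∈ H²(ℙⁿ(ℂ); ℂ)`,
there are a projective embedding `e'` and a non-zero rational `a'` with `e'^*a' = μ·(d·e^*a + ψ^*e^*a)`, `μ ∈ ℚˣ`:
`e'` is the graph `(𝟙, ψ) : P ↪ P × P` composed with `s_{d-1}(e) × e` (the `(d-1)`-st Segre–diagonal power of `e`
times `e`) and the Segre embedding, whose hyperplane class is `d·e^*g + ψ^*e^*g` for the tree's Segre-additive rational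
generators `g` (`exists_segreHyperplaneClasses`, `map_segrePow_of_additive`), and `a = μ⁻¹·g` on the line
`H²(ℙⁿ(ℂ); ℂ)` (`exists_isRationalClass_forall_eq_smul_projectiveSpace`, `exists_ratCast_eq_of_isRationalClass_smul`).
The construction is the first half of the tree's `exists_symmetricSegreEmbedding`, for an ARBITRARY embedding `e`.
[cite: Hartshorne1977, II Ex. 5.11 and Ex. 5.12] [cite: Markman2025SurveySecant, §11.5 Step 2] -/
theorem exists_projectiveEmbedding_symmetrised {d : ℕ} (hd : 0 < d) {P : AbelianVariety ℂ} {ψ : P ⟶ P}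
    (hψ : ψ ≫ ψ = -(d • 𝟙 P)) (e : ProjectiveEmbedding P.X) {a : complexBetti (projectiveSpace e.n ℂ) 2}
    (ha : IsRationalClass a) (ha0 : a ≠ 0) :
    ∃ (e' : ProjectiveEmbedding P.X) (a' : complexBetti (projectiveSpace e'.n ℂ) 2) (μ : ℚ),
      IsRationalClass a' ∧ a' ≠ 0 ∧ μ ≠ 0 ∧
      complexBetti.map e'.ι 2 a' =
        ((μ : ℚ) : ℂ) • ((d : ℂ) • complexBetti.map e.ι 2 a + complexBetti.map ψ.hom.hom.hom 2 (complexBetti.map e.ι 2 a)) := by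
  obtain ⟨d', rfl⟩ : ∃ d', d = d' + 1 := ⟨d - 1, by omega⟩
  clear hd
  obtain ⟨g, hgr, hgnz, hgσ⟩ := exists_segreHyperplaneClasses
  -- the ambient dimension of `e` is positive (else `H²(ℙ⁰(ℂ); ℂ) = 0` and `a = 0`)
  have hN : 1 ≤ e.n := by
    by_contra hlt
    have h0 : e.n = 0 := by omega
    have hP0 : IsSmoothProjective 0 (projectiveSpace e.n ℂ) := by
      rw [h0]; exact isSmoothProjective_projectiveSpace' 0
    haveI : Subsingleton (complexBetti (projectiveSpace e.n ℂ) 2) :=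
      Motives.ComplexPoints.subsingleton_singularCohomology_of_lt hP0 ℂ (k := 2) (by omega)
    exact ha0 (Subsingleton.elim a 0)
  -- `a = q • g_n` with `q ∈ ℚ`, `q ≠ 0` (two rational classes on the line `H²(ℙⁿ(ℂ); ℂ)`)
  obtain ⟨r₀, -, hr₀⟩ := exists_isRationalClass_forall_eq_smul_projectiveSpace e.n
  obtain ⟨za, hza⟩ := hr₀ a
  obtain ⟨zg, hzg⟩ := hr₀ (g e.n)
  have hzg0 : zg ≠ 0 := fun h ↦ hgnz e.n hN (by rw [hzg, h, zero_smul])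
  have haz : a = (za / zg) • g e.n := by
    rw [hzg, smul_smul, div_mul_cancel₀ za hzg0, ← hza]
  obtain ⟨q, hq⟩ := exists_ratCast_eq_of_isRationalClass_smul (hgr e.n) (hgnz e.n hN)
    (z := za / zg) (by rw [← haz]; exact ha)
  have hq0 : q ≠ 0 := by
    rintro rfl
    apply ha0
    rw [haz, ← hq, Rat.cast_zero, zero_smul]
  -- the re-embedding: graph of `ψ`, then `s_{d'}(e) × e`, then Segre
  haveI := e.isClosedImmersion
  obtain ⟨ιK, hιK⟩ : ∃ ι : P.X ⟶
      projectiveSpace (ProjectiveSpace.segrePowDim e.n d' * e.n + ProjectiveSpace.segrePowDim e.n d' + e.n) ℂ,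
      ι = CartesianMonoidalCategory.lift (𝟙 P.X) ψ.hom.hom.hom ≫
        ((e.ι ≫ ProjectiveSpace.segrePow e.n ℂ d') ⊗ₘ e.ι) ≫ segreEmbedding (ProjectiveSpace.segrePowDim e.n d') e.n ℂ :=
    ⟨_, rfl⟩
  haveI := isClosedImmersion_segrePow_left e.n d'
  haveI : IsClosedImmersion (e.ι ≫ ProjectiveSpace.segrePow e.n ℂ d').left := by
    change IsClosedImmersion (e.ι.left ≫ (ProjectiveSpace.segrePow e.n ℂ d').left); infer_instance
  haveI := isClosedImmersion_tensorHom_left (e.ι ≫ ProjectiveSpace.segrePow e.n ℂ d') e.ι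
  haveI := isClosedImmersion_lift_id_left (X := P.X) (Y := P.X) ψ.hom.hom.hom
  have hιKci : IsClosedImmersion ιK.left := by
    rw [hιK]
    change IsClosedImmersion ((CartesianMonoidalCategory.lift (𝟙 P.X) ψ.hom.hom.hom).left ≫
      (((e.ι ≫ ProjectiveSpace.segrePow e.n ℂ d') ⊗ₘ e.ι).left ≫
        (segreEmbedding (ProjectiveSpace.segrePowDim e.n d') e.n ℂ).left))
    infer_instance
  -- its hyperplane class: `(d'+1) • e^*g + ψ^* e^*g`
  have hcl : complexBetti.map ιK 2
      (g (ProjectiveSpace.segrePowDim e.n d' * e.n + ProjectiveSpace.segrePowDim e.n d' + e.n)) =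
      ((d' + 1 : ℕ) : ℂ) • complexBetti.map e.ι 2 (g e.n) +
        complexBetti.map ψ.hom.hom.hom 2 (complexBetti.map e.ι 2 (g e.n)) := by
    rw [hιK, map_comp_apply', map_comp_apply', hgσ (ProjectiveSpace.segrePowDim e.n d') e.n, map_add, map_add,
      map_tensorHom_map_fst, map_tensorHom_map_snd, map_lift_map_fst, map_lift_map_snd, complexBetti.map_id,
      ModuleCat.id_apply, map_comp_apply', map_segrePow_of_additive g hgσ e.n d', map_smul]
  have hbig : 1 ≤ ProjectiveSpace.segrePowDim e.n d' * e.n + ProjectiveSpace.segrePowDim e.n d' + e.n :=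
    le_trans hN (Nat.le_add_left _ _)
  refine ⟨⟨_, ιK, hιKci⟩, g _, q⁻¹, hgr _, hgnz _ hbig, inv_ne_zero hq0, ?_⟩
  change complexBetti.map ιK 2 (g _) = _
  rw [hcl, haz, ← hq]
  simp only [map_smul, smul_add, smul_smul]
  have hqC : ((q : ℚ) : ℂ) ≠ 0 := by exact_mod_cast hq0
  have h1 : ((q : ℚ) : ℂ)⁻¹ * (((d' + 1 : ℕ) : ℂ) * ((q : ℚ) : ℂ)) = ((d' + 1 : ℕ) : ℂ) := by
    field_simp
  have h2 : ((q : ℚ) : ℂ)⁻¹ * ((q : ℚ) : ℂ) = 1 := inv_mul_cancel₀ hqC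
  rw [Rat.cast_inv, h1, h2, one_smul]

end Reembed

end Summit.HodgeConjecture.HodgeConjecture.Theorems

end
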